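import Summits.BirchSwinnertonDyer.BirchSwinnertonDyer.Theorems.KatoDescentPotSupersingularWildUpperReducibleNineTorsionKodaira
import Summits.BirchSwinnertonDyer.Rank1Residual.Additive.KodairaDictionaryThree
import Literature.NumberTheory.EllipticCurves.SemistabilityDefectIsogenyProofs
import Literature.NumberTheory.EllipticCurves.SemistabilityDefectAtThreeTameWitnessProofs
import Literature.NumberTheory.EllipticCurves.SemistabilityDefectDiscriminantBoundProofs
import Literature.NumberTheory.EllipticCurves.IsogenyNeronScalingMinimalDiscriminantDirectionProofs
import Literature.NumberTheory.EllipticCurves.IsogenyDualProofs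
import HarnessLib

/-!
# Routes `KatoDescentTamePotSupersingular` (K8-t′) / `KatoDescentPotSupersingular` (K9), cell `bsd-potss`:
# the ISOGENY-CLASS TORSION BINDER «some `W' ∼ W` has `9 ∣ #W'(ℚ)_tors`» at the additive prime `3`,
# READ THROUGH THE SEMISTABILITY DEFECT — UNCONDITIONALLY (no Ogg–Saito, no Mazur, no certificate)
# ROUTE-FREE (imports no `Theses.*` file); a `--supports … --as helper` file (seat `bsd-potss-k9-c4` g20,
# TARGET R280 «torsion-binder door»); nothing booked, no item closed, BSD is not proved by any of this

WHERE THIS SITS. The reducible-defect cruxes U₀-red of both routes (K9 `WildUpperReducibleDefect` 19190,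
K8-t′ `TameUpperReducibleDefect` 19203) and their U₀ parents (19197 / 19982) carry the binder
`(∀ W' elliptic, W ∼ W' → ¬ p² ∣ #W'(ℚ)_tors)` — the side condition of Kato's member bound (crux M). On
the K8-t′ side the binder was discharged STRUCTURALLY by seat k8t-c4 (`…TameUpperReducibleTorsionVoid`,
`…TameUpperReducibleNodes`): unconditionally at `p ≥ 5` (local torsion at the additive prime), but at
`p = 3` only GRANTED OGG–SAITO (`hOS : artinConductorExponent_tate_eq_conductorExponent_of_isElliptic`,
used to transport `f₃ = 2` along the isogeny). On the K9 side seat k9-red9 proved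
(`…WildUpperReducibleNineTorsionKodaira`, UNCONDITIONAL, any equation): a curve additive at `3` with
`9 ∣ #E(ℚ)_tors` is of Kodaira type `IV` at `3` with `f₃ = 3`, `ord₃ Δ_min = 5`.

THIS FILE removes the Ogg–Saito hypothesis, replacing the conductor by Kraus's SEMISTABILITY DEFECT
`W.semistabilityDefectAt 3` (Literature `SemistabilityDefect.lean`), which IS a `ℚ`-isogeny invariant in the
tree (`IsIsogenous.semistabilityDefectAt_eq`, Coppola 2020 §2 / Silverman VII.7.2, PROVED):

* §1 `twelve_dvd_semistabilityDefectAt_three_of_nine_dvd_torsionOrder` — additive at `3` with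
  `9 ∣ #E(ℚ)_tors` ⟹ `12 ∣ defect₃(E)` (`ord₃ Δ_min = 5` and `12 / gcd(12, ord₃ Δ_min) ∣ defect`,
  `twelve_div_gcd_ordMinimalDiscriminant_dvd_semistabilityDefectAt`, Silverman VII.5.5); hence
  `twelve_dvd_semistabilityDefectAt_three_of_isIsogenous_of_nine_dvd_torsionOrder` — **if some `W' ∼ W`
  has `9 ∣ #W'(ℚ)_tors` then `12 ∣ defect₃(W)` for the additive row `W` itself**.
* §2 the TAME rows: `defect₃ = 4` on Kodaira `III`/`III*` and `= 2` on `I₀*`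
  (`semistabilityDefectAt_eq_four_of_kodairaSymbolAt_eq_III_or_IIIstar`, `…_eq_two_of_…_Istar_zero`,
  PROVED in `SemistabilityDefectAtThreeTameWitnessProofs`), and on `Iₙ*` (`n ≥ 1`) the row is potentially
  multiplicative while the `ℤ/9` member is potentially good (type `IV`) — potential good reduction being an
  isogeny invariant (`padicValRat_j_nonneg_of_isogeny`). So
  **`not_nine_dvd_torsionOrder_of_isIsogenous_of_condExpTwo_three`: `Addv W 3 → f₃(W) = 2 → W ∼ W' →
  9 ∤ #W'(ℚ)_tors`** for EVERY elliptic `W'` — the whole tame locus at `3` ((M), (G-ord), (t′)), and in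
  particular `not_nine_dvd_torsionOrder_of_isIsogenous_of_subTprime_three` = k8t-c4's theorem of the
  same name WITHOUT its `hOS` binder.
* §3 packaging: the crux binder `∀ W' …, ¬ 3² ∣ #W'(ℚ)_tors` HOLDS on every `f₃ = 2` row
  (`forall_isIsogenous_not_nine_dvd_torsionOrder_of_condExpTwo_three`); contrapositively a row whose class
  meets `X₁(9)` lies in the WILD cell with `12 ∣ defect₃` (`subW_of_nineTorsionMember`,
  `twelve_dvd_semistabilityDefectAt_three_of_nineTorsionMember`) — the K9 reading: among the wild rows
  only those of defect `12` (not `3`, `6`) can carry the `ℤ/9` disjunct of crux 19190.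

HONEST FRAMING. Theorems only (no `def`, no named fact, no `sorry`); every statement is UNCONDITIONAL.
Nothing here bounds `Ш`; no item is closed; the R280 instrument found NO landed K9/KT row theorem
displaying the binder undischarged (report HOME/k9-c4/g20/), so this class-wide discharge is the door's
whole content on the (t′) side; on the wild side the per-row door stays the point-count certificate
`AddKatoTwo.forall_isIsogenous_not_dvd_torsionOrder_of_not_dvd_reductionPointCount` (unused: no consumer).

References: [SilvermanAEC2009] VII.5 Prop. 5.5, Cor. VII.7.2, VIII.8 Cor. 8.3; [Coppola2020] §2 (Thm. 2.7);
[Kraus1990]; [SilvermanATAEC1994] IV.9 Table 4.1; [BarriosRoy2022LocalData] Thm. 3.8 (row `T = C₉`).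
-/

set_option autoImplicit false
-- the Theorems directory repeats the summit name (sibling precedent `KatoDescentPotSupersingularAssembly.lean`)
set_option linter.dupNamespace false

noncomputable section

open scoped Classical

namespace Summit.BirchSwinnertonDyer.BirchSwinnertonDyer.Theorems.NineTorsionMemberDefect

open WeierstrassCurve IsDedekindDomain Rat.HeightOneSpectrum Literature.NumberTheory.EllipticCurves
  Literature.NumberTheory.DiophantineGeometry
  Literature.NumberTheory.EllipticCurves.Rank1Residual
  Summit.BirchSwinnertonDyer.Rank1Residual
  Summit.BirchSwinnertonDyer.Rank1Residual.Additive
  Summit.BirchSwinnertonDyer.BirchSwinnertonDyer.Theorems.WildUpperReducibleNineTorsionKodaira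

variable {W W' : WeierstrassCurve ℚ} [W.IsElliptic] [W'.IsElliptic] [Fact (Nat.Prime 3)]

/-! ## §1 A `ℤ/9` curve additive at `3` has semistability defect divisible by `12` — and so does its class -/

/-- **Additive at `3` with `9 ∣ #E(ℚ)_tors ⟹ `12 ∣ defect₃(E)`** (any equation). The curve is of Kodaira type
`IV` at `3` with `ord₃ Δ_min = 5` (`kodairaIV_of_nine_dvd_torsionOrder`, Barrios–Roy row `T = C₉`), hence
potentially good (the wild cell `SubW`), and `12 / gcd(12, 5) = 12` divides the semistability defect
(Silverman VII.5.5 in the tree's form `twelve_div_gcd_ordMinimalDiscriminant_dvd_semistabilityDefectAt`).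
[cite: SilvermanAEC2009, VII.5 Prop. 5.5 (proof) and VII.1 Prop. 1.3] [cite: BarriosRoy2022LocalData, Thm. 3.8 (table, T = C₉)] -/
theorem twelve_dvd_semistabilityDefectAt_three_of_nine_dvd_torsionOrder (hadd : Addv W 3)
    (h9 : 3 ^ 2 ∣ W.torsionOrder) : 12 ∣ W.semistabilityDefectAt 3 := by
  obtain ⟨hIV, -, h5⟩ := kodairaIV_of_nine_dvd_torsionOrder W hadd h9
  have hW : SubW W 3 := (subW_three_iff_kodairaSymbolAt_wild W hadd).mpr (Or.inr (Or.inl hIV))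
  have hj : 0 ≤ padicValRat 3 W.j := not_lt.mp hW.1
  have h := W.twelve_div_gcd_ordMinimalDiscriminant_dvd_semistabilityDefectAt (placeOf 3)
    (primesEquiv_placeOf_val 3) hj
  rwa [h5, show 12 / Nat.gcd 12 5 = 12 by decide] at h

/-- **If some `W' ∼ W` has `9 ∣ #W'(ℚ)_tors`, then `12 ∣ defect₃(W)`** for the additive row `W` itself: the
defect is a `ℚ`-isogeny invariant (`IsIsogenous.semistabilityDefectAt_eq`, Coppola 2020 §2 with Silverman
VII.7.2) and additive reduction transports along the isogeny (`X2.addv_iff_of_isIsogenous`). UNCONDITIONAL.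
[cite: Coppola2020, §2 (definition of L via ρ_{E,ℓ} restricted to inertia; arXiv:1812.05651)]
[cite: SilvermanAEC2009, Cor. VII.7.2 and VII.5 Prop. 5.5] -/
theorem twelve_dvd_semistabilityDefectAt_three_of_isIsogenous_of_nine_dvd_torsionOrder (hadd : Addv W 3)
    (hiso : IsIsogenous W W') (h9 : 3 ^ 2 ∣ W'.torsionOrder) : 12 ∣ W.semistabilityDefectAt 3 := by
  rw [hiso.semistabilityDefectAt_eq 3]
  exact twelve_dvd_semistabilityDefectAt_three_of_nine_dvd_torsionOrder
    ((X2.addv_iff_of_isIsogenous (p := 3) hiso).mp hadd) h9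

/-- The `ℤ/9` member is POTENTIALLY GOOD at `3` (type `IV`, wild cell): `0 ≤ ord₃ j(W')`, any equation.
[cite: BarriosRoy2022LocalData, Thm. 3.8 (table, T = C₉: type IV)] [cite: SilvermanATAEC1994, IV.9 Table 4.1] -/
theorem padicValRat_j_nonneg_of_isIsogenous_of_nine_dvd_torsionOrder (hadd : Addv W 3)
    (hiso : IsIsogenous W W') (h9 : 3 ^ 2 ∣ W'.torsionOrder) : 0 ≤ padicValRat 3 W'.j := by
  have hadd' : Addv W' 3 := (X2.addv_iff_of_isIsogenous (p := 3) hiso).mp hadd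
  obtain ⟨hIV, -, -⟩ := nineTorsionMember_kodairaIV hadd hiso h9
  have hW' : SubW W' 3 := (subW_three_iff_kodairaSymbolAt_wild W' hadd').mpr (Or.inr (Or.inl hIV))
  exact not_lt.mp hW'.1

/-! ## §2 The TAME rows at `3` (`f₃ = 2`: Kodaira `Iₙ*`, `III`, `III*`) have NO `ℤ/9` member — unconditionally -/

/-- **Kodaira `III` / `III*` at `3` (the (t′) cell, `e = 4`): no `ℚ`-isogenous curve has `9 ∣ #E'(ℚ)_tors`.**
The defect of the row is `4` (`semistabilityDefectAt_eq_four_of_kodairaSymbolAt_eq_III_or_IIIstar`, PROVED: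
witness `ℚ(3^{1/4})`-type field + `12/gcd(12, ord Δ) ∣ defect`), but a `ℤ/9` member would force `12 ∣ 4` (§1).
UNCONDITIONAL replacement of the Ogg–Saito-conditional transport of `f₃ = 2`.
[cite: Coppola2020, §2 Thm. 2.7 (types III, III*: defect 4)] [cite: SilvermanAEC2009, Cor. VII.7.2 and VII.5 Prop. 5.5] -/
theorem not_nine_dvd_torsionOrder_of_isIsogenous_of_kodairaSymbolAt_III_or_IIIstar (hadd : Addv W 3)
    (hK : W.kodairaSymbolAt (placeOf 3) = .III ∨ W.kodairaSymbolAt (placeOf 3) = .IIIstar)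
    (hiso : IsIsogenous W W') : ¬ 3 ^ 2 ∣ W'.torsionOrder := fun h9 ↦ by
  have h12 := twelve_dvd_semistabilityDefectAt_three_of_isIsogenous_of_nine_dvd_torsionOrder hadd hiso h9
  rw [W.semistabilityDefectAt_eq_four_of_kodairaSymbolAt_eq_III_or_IIIstar (placeOf 3)
    (primesEquiv_placeOf_val 3) (by decide) hK] at h12
  revert h12
  decide

/-- **Kodaira `I₀*` at `3` (the (G-ord) cell, `e = 2`): no `ℚ`-isogenous curve has `9 ∣ #E'(ℚ)_tors`** —
defect `2` (`semistabilityDefectAt_eq_two_of_kodairaSymbolAt_eq_Istar_zero`, PROVED), and `12 ∤ 2`.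
[cite: Coppola2020, §2 Thm. 2.7, first clause (type I₀*: defect 2)] [cite: SilvermanAEC2009, Cor. VII.7.2 and VII.5 Prop. 5.5] -/
theorem not_nine_dvd_torsionOrder_of_isIsogenous_of_kodairaSymbolAt_Istar_zero (hadd : Addv W 3)
    (hK : W.kodairaSymbolAt (placeOf 3) = .Istar 0) (hiso : IsIsogenous W W') :
    ¬ 3 ^ 2 ∣ W'.torsionOrder := fun h9 ↦ by
  have h12 := twelve_dvd_semistabilityDefectAt_three_of_isIsogenous_of_nine_dvd_torsionOrder hadd hiso h9
  rw [W.semistabilityDefectAt_eq_two_of_kodairaSymbolAt_eq_Istar_zero (placeOf 3)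
    (primesEquiv_placeOf_val 3) (by decide) hK] at h12
  revert h12
  decide

/-- **Kodaira `Iₙ*`, `n ≥ 1`, at `3` (the (M) cell, potentially multiplicative): no `ℚ`-isogenous curve has
`9 ∣ #E'(ℚ)_tors`** — the row has `ord₃ j < 0` (`potMult_three_iff_kodairaSymbolAt_Istar_succ`) while the
`ℤ/9` member is potentially good (§1), and potential good reduction passes back along the dual isogeny
(`IsIsogenous.symm_of_charZero`, `padicValRat_j_nonneg_of_isogeny`).
[cite: SilvermanAEC2009, Cor. VII.7.2 and Prop. VII.5.5] [cite: SilvermanATAEC1994, IV.9 Table 4.1] -/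
theorem not_nine_dvd_torsionOrder_of_isIsogenous_of_kodairaSymbolAt_Istar_succ (hadd : Addv W 3) {n : ℕ}
    (hK : W.kodairaSymbolAt (placeOf 3) = .Istar (n + 1)) (hiso : IsIsogenous W W') :
    ¬ 3 ^ 2 ∣ W'.torsionOrder := fun h9 ↦ by
  have hj' := padicValRat_j_nonneg_of_isIsogenous_of_nine_dvd_torsionOrder hadd hiso h9
  have hmult : PotMult W 3 := (potMult_three_iff_kodairaSymbolAt_Istar_succ W hadd).mpr ⟨n, hK⟩
  obtain ⟨φ⟩ := hiso.symm_of_charZero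
  have hj : 0 ≤ padicValRat 3 W.j := padicValRat_j_nonneg_of_isogeny φ Nat.prime_three hj'
  exact absurd hmult (not_lt.mpr hj)

/-- **The whole TAME locus at `3`: `Addv W 3 → f₃(W) = 2 → W ∼ W' → 9 ∤ #W'(ℚ)_tors`**, for EVERY elliptic `W'`
(any equation), UNCONDITIONALLY. `f₃ = 2` ⟺ Kodaira `III`/`III*`/`Iₙ*` (`condExpTwo_three_iff_kodairaSymbolAt_tame`);
the three previous theorems. [cite: SilvermanATAEC1994, IV.9.4 and Table 4.1 (PDF p. 365)]
[cite: Coppola2020, §2 Thm. 2.7] [cite: SilvermanAEC2009, Cor. VII.7.2 and VII.5 Prop. 5.5] -/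
theorem not_nine_dvd_torsionOrder_of_isIsogenous_of_condExpTwo_three (hadd : Addv W 3)
    (hf : CondExpTwo W 3) (hiso : IsIsogenous W W') : ¬ 3 ^ 2 ∣ W'.torsionOrder := by
  rcases (condExpTwo_three_iff_kodairaSymbolAt_tame W hadd).mp hf with hIII | hIIIs | ⟨n, hn⟩
  · exact not_nine_dvd_torsionOrder_of_isIsogenous_of_kodairaSymbolAt_III_or_IIIstar hadd (Or.inl hIII) hiso
  · exact not_nine_dvd_torsionOrder_of_isIsogenous_of_kodairaSymbolAt_III_or_IIIstar hadd (Or.inr hIIIs) hiso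
  · rcases n with _ | n
    · exact not_nine_dvd_torsionOrder_of_isIsogenous_of_kodairaSymbolAt_Istar_zero hadd hn hiso
    · exact not_nine_dvd_torsionOrder_of_isIsogenous_of_kodairaSymbolAt_Istar_succ hadd hn hiso

/-- **On a (t′) row at `3` NO `ℚ`-isogenous curve has `9 ∣ #E'(ℚ)_tors` — UNCONDITIONALLY** (the census cell
`SubTprime W 3` contains `f₃ = 2`). This is `…TameUpperReducibleTorsionVoid`'s
`not_nine_dvd_torsionOrder_of_isIsogenous_of_subTprime_three` with its Ogg–Saito binder `hOS` REMOVED.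
[cite: Coppola2020, §2 Thm. 2.7 (types III, III*: defect 4)] [cite: SilvermanAEC2009, Cor. VII.7.2 and VII.5 Prop. 5.5] -/
theorem not_nine_dvd_torsionOrder_of_isIsogenous_of_subTprime_three [W.IsGloballyMinimal] (hadd : Addv W 3)
    (hT : SubTprime W 3) (hiso : IsIsogenous W W') : ¬ 3 ^ 2 ∣ W'.torsionOrder :=
  not_nine_dvd_torsionOrder_of_isIsogenous_of_condExpTwo_three hadd hT.2.1 hiso

/-! ## §3 Packaging: the crux binder on the tame rows; the wild cell and defect `12` on the `ℤ/9` rows -/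

/-- **The cruxes' torsion binder HOLDS on every `f₃ = 2` row**: `∀ W' elliptic, W ∼ W' → ¬ 3² ∣ #W'(ℚ)_tors`
(the literal second conjunct of the covered family B of `TameUpperDefectRankZero` / `WildUpperDefectRankZero`
at `p = 3`). UNCONDITIONAL. [cite: Coppola2020, §2 Thm. 2.7] [cite: SilvermanAEC2009, Cor. VII.7.2 and VII.5 Prop. 5.5] -/
theorem forall_isIsogenous_not_nine_dvd_torsionOrder_of_condExpTwo_three (hadd : Addv W 3)
    (hf : CondExpTwo W 3) :
    ∀ (W' : WeierstrassCurve ℚ) [W'.IsElliptic], IsIsogenous W W' → ¬ 3 ^ 2 ∣ W'.torsionOrder :=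
  fun _ _ hiso ↦ not_nine_dvd_torsionOrder_of_isIsogenous_of_condExpTwo_three hadd hf hiso

/-- The (t′) form of the binder: `∀ W' elliptic, W ∼ W' → ¬ 3² ∣ #W'(ℚ)_tors` on every `SubTprime W 3` row,
UNCONDITIONALLY (the `p = 3` half of the `ℤ/p²` disjunct of crux 19203 is VOID with no named fact).
[cite: Coppola2020, §2 Thm. 2.7] [cite: SilvermanAEC2009, Cor. VII.7.2 and VII.5 Prop. 5.5] -/
theorem forall_isIsogenous_not_nine_dvd_torsionOrder_of_subTprime_three [W.IsGloballyMinimal]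
    (hadd : Addv W 3) (hT : SubTprime W 3) :
    ∀ (W' : WeierstrassCurve ℚ) [W'.IsElliptic], IsIsogenous W W' → ¬ 3 ^ 2 ∣ W'.torsionOrder :=
  fun _ _ hiso ↦ not_nine_dvd_torsionOrder_of_isIsogenous_of_subTprime_three hadd hT hiso

/-- **The `ℤ/9` disjunct lives in the WILD cell**: if the class of a row additive at `3` meets `X₁(9)` (the
cruxes' `∃ W' …, 3² ∣ #W'(ℚ)_tors`), the row is `SubW W 3` (`f₃ ≠ 2`, not potentially multiplicative).
UNCONDITIONAL; sharpens k9-red9's `not_subTprime_three_of_nine_dvd_torsionOrder` (one curve, (t′) only) to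
the whole class and the whole tame locus. [cite: Coppola2020, §2 Thm. 2.7] [cite: SilvermanAEC2009, Cor. VII.7.2 and Prop. VII.5.5] -/
theorem subW_of_nineTorsionMember (hadd : Addv W 3)
    (h : ∃ (W' : WeierstrassCurve ℚ) (_ : W'.IsElliptic), IsIsogenous W W' ∧ 3 ^ 2 ∣ W'.torsionOrder) :
    SubW W 3 := by
  obtain ⟨W', hE', hiso, h9⟩ := h
  refine ⟨fun hmult ↦ ?_, fun hf ↦ not_nine_dvd_torsionOrder_of_isIsogenous_of_condExpTwo_three hadd hf hiso h9⟩
  have hj' := padicValRat_j_nonneg_of_isIsogenous_of_nine_dvd_torsionOrder hadd hiso h9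
  obtain ⟨φ⟩ := hiso.symm_of_charZero
  exact absurd hmult (not_lt.mpr (padicValRat_j_nonneg_of_isogeny φ Nat.prime_three hj'))

/-- **… and has semistability defect divisible by `12`** (so among the wild rows — defects `3, 4, 6, 12` in
Kraus's classification — only the defect-`12` rows can carry the `ℤ/9` disjunct of crux 19190). UNCONDITIONAL.
[cite: Coppola2020, §2 Thm. 2.7] [cite: SilvermanAEC2009, Cor. VII.7.2 and VII.5 Prop. 5.5] -/
theorem twelve_dvd_semistabilityDefectAt_three_of_nineTorsionMember (hadd : Addv W 3)
    (h : ∃ (W' : WeierstrassCurve ℚ) (_ : W'.IsElliptic), IsIsogenous W W' ∧ 3 ^ 2 ∣ W'.torsionOrder) :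
    12 ∣ W.semistabilityDefectAt 3 := by
  obtain ⟨W', hE', hiso, h9⟩ := h
  exact twelve_dvd_semistabilityDefectAt_three_of_isIsogenous_of_nine_dvd_torsionOrder hadd hiso h9

end Summit.BirchSwinnertonDyer.BirchSwinnertonDyer.Theorems.NineTorsionMemberDefect

end
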